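import Summits.CriticalPhenomena.PercolationContinuityZ3.Theorems.PercNearOneGluingNoHeavyLowerTailCubicThreePointShadowHubCoeffs
import Mathlib.Tactic.Ring
import Mathlib.Tactic.Linarith
import Mathlib.Tactic.Positivity
import Mathlib.Tactic.LinearCombination
import HarnessLib

/-!
# `NoHeavyLowerTail` (stmt-CriticalPhenomena-4575) — the SHADOW form of the sharp cubic three-point row: algebraic core and the hub-gluing step

Support file (prover prim-gen-kcluster gen 14, k-cluster line; `--supports stmt-CriticalPhenomena-4575`).  Pure real algebra: no measure
theory, no named facts, no sorries.  Cell convention of `…CubicThreePointTerminalClosure` (`CubicThreePointTerminal.AG/Ha/Hb`; all three are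
symmetric in the petals, here written `(q, ua, ub, uc, t)` = `(P(a|b|c), P(bc|a), P(ac|b), P(ab|c), P(abc))` of a weighted graph with terminals `a,b,c`).

## The shadow form (memo run/shared/lean/prim/prim-gen-kcluster/W-SHADOW.md)
Under the cluster-exploration tree of terminal `a` the two credit masses of the gain split are ORDER-FREE: with
`X = X_a :=` P(ω ∈ P_a, ω′ ∈ {b~c}, every open `b–c` path of ω′ meets the vertex set of the `a`-cluster of ω) ("shadow mass", two independent copies)
one has `X = E[s_a(s_b+s_c)]`, `AG − X = E[(b_b+s_c)(b_c+s_b)] ≥ 0`, and the censused sharp row `max(Ha,Hb) ≥ 0` follows from the single polynomial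
inequality  **W_a:  S_a := Ha − (t−q)·X ≥ 0**  (`maxH_nonneg_of_shadow` below; W_a is tight on hub AND on blob networks, 0 violations in ≈ 10⁵ exact
checks, implied classwise by the N_a census).  A Cauchy–Schwarz argument PROVES the companion bound  `(q+ua)·X ≤ ua·(AG + ub·uc)`  (`shadow_cs_bound`:
the algebra; the probabilistic input is `M₂·d_a ≥ u_a²` for `M₂ = E[1_D g(C_a)²]`, `X = ua(t+ua) − M₂`).

## The hub-gluing step (this file's main content)
Glue a new Steiner vertex `s` to `a, b, c` with arm weights `p, β, γ` onto a graph `G₋` with law `(q,ua,ub,uc,t)` and shadow `X`.  The exact one-edge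
formulas of the memo (Theorem 3: terminal edges; Theorem 4: telescoping along `e=(a,s)`) express the shadow slack of the glued graph as
  `S_glued(p) = (1−p)·S(G₋+bc(βγ)) + p²·S(G₋+ab(β)+ac(γ)) + p(1−p)·[(1−p)·Ψ₀ + p·Ψ₁]`,   `Ψ₀, Ψ₁` = `hubPsi0`, `hubPsi1` below
(explicit polynomials in `(q,ua,ub,uc,t,X,β,γ)`, bidegree `(3,3)` in `(β,γ)`, affine in `X`; verified against brute-force enumeration on 600 random
weighted graphs to 1e-12, code/gen14/starvertex_formula.py).  THIS FILE PROVES: for every `(q,ua,ub,uc,t) ≥ 0` on the simplex with `AG ≥ 0`, every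
`X` with `0 ≤ X ≤ AG`, `(t−q)X ≤ Ha` (= W_a of `G₋`) and `(q+ua)X ≤ ua(AG+ub·uc)` (= the Cauchy–Schwarz bound), and all `β, γ ∈ [0,1]`:
`Ψ₀ ≥ 0` and `Ψ₁ ≥ 0` (`hubPsi0_nonneg`, `hubPsi1_nonneg`), hence `S_glued(p) ≥ 0` for `p ∈ [0,1]` (`hubGlued_nonneg`).  Method: the 16 Bernstein
coefficients of `Ψ` in `(β,γ)` are cubics in `(q,u,t,X)`; each nonzero one has an exact Handelman certificate (nonnegative rational combination of
products of the atoms `q,ua,ub,uc,t,X, AG, AG−X, Ha−(t−q)X, ua(AG+ub·uc)−(q+ua)X`, kit job j089230, 307 terms), replayed here by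
`linear_combination` (identity modulo the simplex relation) + explicit `mul_nonneg`/`add_nonneg` terms.
CONSEQUENCE (modulo the probabilistic identification, which is a paper proof in the memo and is NOT formalised here): Conjecture W_a — hence the
sharp row `max(Ha,Hb) ≥ 0` in the strengthened shadow form — is preserved under gluing a hub with arbitrary arm weights; together with the terminal-edge
and pendant formulas it holds for every 3-terminal graph generated from three isolated terminals by terminal edges, pendant moves, hub gluing and
series/parallel reweighting (stars, triangles, `K₄`, `K_{2,3}`, `K_{3,3}`, the prism, …).
[cite: Gladkov2024StrongFKG, Cor. 4.2 (AG ≥ 0)]; [cite: GladkovZimin2024HK, §4 (decision-tree hybrids)]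
-/

namespace Summit.CriticalPhenomena.PercolationContinuityZ3.Theorems

namespace CubicThreePointShadow

open CubicThreePointTerminal

/-! ### The shadow form implies the sharp dichotomy; the Cauchy–Schwarz companion (algebra only) -/

/-- W_a ⇒ SF3-Hmax (algebra): if `0 ≤ X ≤ AG` and `Ha − (t−q)·X ≥ 0` then `max(Ha, Hb) ≥ 0`
(`t ≥ q`: `Ha ≥ (t−q)X ≥ 0`; `t ≤ q`: `Hb = Ha + (q−t)·AG ≥ Ha + (q−t)·X ≥ 0`). [folklore] -/
theorem maxH_nonneg_of_shadow (q ua ub uc t X : ℝ) (hX : 0 ≤ X) (hXA : X ≤ AG q ua ub uc t)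
    (hW : 0 ≤ Ha q ua ub uc t - (t - q) * X) : 0 ≤ max (Ha q ua ub uc t) (Hb q ua ub uc t) := by
  have hid : Hb q ua ub uc t = Ha q ua ub uc t + (q - t) * AG q ua ub uc t := by simp only [Ha, Hb, AG]; ring
  rcases le_total q t with hqt | htq
  · have h1 : 0 ≤ (t - q) * X := mul_nonneg (by linarith) hX
    exact le_max_of_le_left (by linarith)
  · have h1 : (q - t) * X ≤ (q - t) * AG q ua ub uc t := mul_le_mul_of_nonneg_left hXA (by linarith)
    exact le_max_of_le_right (by nlinarith)

/-- Cauchy–Schwarz companion V_a (algebra): with `X = ua·(t+ua) − M₂` and `(q+ua)·M₂ ≥ ua²` (Cauchy–Schwarz for `M₂ = E[1_D g²]`,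
`E[1_D g] = ua`, `E[1_D] = q+ua`) one gets `(q+ua)·X ≤ ua·(AG + ub·uc)` on the simplex. [folklore] -/
theorem shadow_cs_bound (q ua ub uc t X M₂ : ℝ) (hσ : q + ua + ub + uc + t = 1) (hXdef : X = ua * (t + ua) - M₂)
    (hCS : ua ^ 2 ≤ (q + ua) * M₂) : (q + ua) * X ≤ ua * (AG q ua ub uc t + ub * uc) := by
  subst hXdef
  simp only [AG]
  nlinarith [hCS, hσ]

/-- Equivalent form of V_a: `S_a = Ha − (t−q)X ≤ (t+ua)·(AG − X)`, i.e. `Hb ≤ (q+ua)·(AG − X)`. [folklore] -/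
theorem shadow_cs_bound' (q ua ub uc t X : ℝ) (hCS : (q + ua) * X ≤ ua * (AG q ua ub uc t + ub * uc)) :
    Ha q ua ub uc t - (t - q) * X ≤ (t + ua) * (AG q ua ub uc t - X) := by
  simp only [Ha, AG] at *; nlinarith [hCS]

/-! ### The hub-gluing polynomials `Ψ₀`, `Ψ₁` -/

/-- `Ψ₀` of the hub-gluing step (W-SHADOW.md §6b/§7): `Ψ₀ = q₀(x_r+X₁) + t₀(y_r+Y₁) + δ_q X₀ + δ_t Y₀ + 2e₃⁰ − mix₁` with the laws/shadows of
`G∖e ≅ G₋ + bc(βγ)` (index 0) and `G/e ≅ G₋ + ab(β) + ac(γ)` (index 1) and the root transition masses of `e = (a,s)`, all expressed through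
`(q,ua,ub,uc,t,X)` of `G₋` by the exact terminal-edge formulas. [conjecture-support: algebraic definition] -/
noncomputable def hubPsi0 (q ua ub uc t X β γ : ℝ) : ℝ :=
  let ρ := β * γ
  let A := q * t - (ua * ub + ua * uc + ub * uc)
  let Y := A - X
  let q0 := (1 - ρ) * q
  let ua0 := ua + ρ * q
  let ub0 := (1 - ρ) * ub
  let uc0 := (1 - ρ) * uc
  let t0 := t + ρ * (ub + uc)
  let X0 := (1 - ρ) * ((1 - ρ) * X + ρ * (A + ub * uc))
  let Y0 := (1 - ρ) * (1 - ρ) * Y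
  let ua1 := (1 - β) * (1 - γ) * ua
  let ub1 := (1 - β) * (ub + γ * q)
  let uc1 := (1 - γ) * (uc + β * q)
  let X1 := (1 - β) * (1 - γ) * (X + β * ua * ub + γ * ua * (uc + β * q))
  let Y1 := (1 - β) * (1 - γ) * Y
  let sa := ρ * (q + ua) + (β * (1 - γ) + γ * (1 - β)) * ua
  let sb := β * (1 - γ) * ub
  let sc := γ * (1 - β) * uc
  let bb := γ * (1 - β) * q
  let bc := β * (1 - γ) * q
  let xr := sa * (sb + sc)
  let yr := (bb + sc) * (bc + sb)
  let dq := -(bb + bc)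
  let dt := sa + sb + sc
  let e30 := ua0 * ub0 * uc0
  let mix1 := ua1 * ub0 * uc0 + ua0 * ub1 * uc0 + ua0 * ub0 * uc1
  q0 * (xr + X1) + t0 * (yr + Y1) + dq * X0 + dt * Y0 + 2 * e30 - mix1

/-- `Ψ₁` of the hub-gluing step: `Ψ₁ = q₁x_r + t₁y_r + q₀X₁ + t₀Y₁ + δ_q X₀ + δ_t Y₀ + e₃⁰ + e₃¹ − mix₂` (notation as in `hubPsi0`).
[conjecture-support: algebraic definition] -/
noncomputable def hubPsi1 (q ua ub uc t X β γ : ℝ) : ℝ :=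
  let ρ := β * γ
  let A := q * t - (ua * ub + ua * uc + ub * uc)
  let Y := A - X
  let q0 := (1 - ρ) * q
  let ua0 := ua + ρ * q
  let ub0 := (1 - ρ) * ub
  let uc0 := (1 - ρ) * uc
  let t0 := t + ρ * (ub + uc)
  let X0 := (1 - ρ) * ((1 - ρ) * X + ρ * (A + ub * uc))
  let Y0 := (1 - ρ) * (1 - ρ) * Y
  let q1 := (1 - β) * (1 - γ) * q
  let ua1 := (1 - β) * (1 - γ) * ua
  let ub1 := (1 - β) * (ub + γ * q)
  let uc1 := (1 - γ) * (uc + β * q)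
  let t1 := t + β * ua + β * ub + γ * (1 - β) * ua + γ * uc + β * γ * q
  let X1 := (1 - β) * (1 - γ) * (X + β * ua * ub + γ * ua * (uc + β * q))
  let Y1 := (1 - β) * (1 - γ) * Y
  let sa := ρ * (q + ua) + (β * (1 - γ) + γ * (1 - β)) * ua
  let sb := β * (1 - γ) * ub
  let sc := γ * (1 - β) * uc
  let bb := γ * (1 - β) * q
  let bc := β * (1 - γ) * q
  let xr := sa * (sb + sc)
  let yr := (bb + sc) * (bc + sb)
  let dq := -(bb + bc)
  let dt := sa + sb + sc
  let e30 := ua0 * ub0 * uc0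
  let e31 := ua1 * ub1 * uc1
  let mix2 := ua0 * ub1 * uc1 + ua1 * ub0 * uc1 + ua1 * ub1 * uc0
  q1 * xr + t1 * yr + q0 * X1 + t0 * Y1 + dq * X0 + dt * Y0 + e30 + e31 - mix2

set_option maxHeartbeats 4000000 in
/-- `Ψ0 ≥ 0` on the hypothesis set, for all arm weights `β, γ ∈ [0,1]` (Bernstein expansion in `(β,γ)` + the coefficient certificates).
[conjecture-support: hub-gluing step of W_a] -/
theorem hubPsi0_nonneg (q ua ub uc t X : ℝ) (hq : 0 ≤ q) (hua : 0 ≤ ua) (hub : 0 ≤ ub) (huc : 0 ≤ uc) (ht : 0 ≤ t) (hX : 0 ≤ X)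
    (hσ : q + ua + ub + uc + t = 1) (hAG : 0 ≤ AG q ua ub uc t) (hAX : 0 ≤ AG q ua ub uc t - X)
    (hW : 0 ≤ Ha q ua ub uc t - (t - q) * X) (hCS : 0 ≤ ua * (AG q ua ub uc t + ub * uc) - (q + ua) * X)
    (β γ : ℝ) (hβ0 : 0 ≤ β) (hβ1 : 0 ≤ 1 - β) (hγ0 : 0 ≤ γ) (hγ1 : 0 ≤ 1 - γ) :
    0 ≤ hubPsi0 q ua ub uc t X β γ := by
  have e : hubPsi0 q ua ub uc t X β γ = ((1:ℝ) * ((1:ℝ) * q * t ^ 2 + (1:ℝ) * q * X + (-1:ℝ) * ua * ub * uc + (-1:ℝ) * ua * ub * t + (-1:ℝ) * ua * uc * t + (-1:ℝ) * ub * uc * t + (-1:ℝ) * t * X) * β ^ 0 * (1 - β) ^ 3 * γ ^ 0 * (1 - γ) ^ 3) + ((3:ℝ) * (((1:ℝ)/3) * q * ua * t + ((1:ℝ)/3) * q * uc * t + ((2:ℝ)/3) * q * t ^ 2 + ((1:ℝ)/3) * q * X + ((-1:ℝ)/3) * ua ^ 2 * ub + ((-1:ℝ)/3) * ua ^ 2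 * uc + (-1:ℝ) * ua * ub * uc + ((-2:ℝ)/3) * ua * ub * t + ((-1:ℝ)/3) * ua * uc ^ 2 + ((-2:ℝ)/3) * ua * uc * t + ((-1:ℝ)/3) * ua * X + ((-1:ℝ)/3) * ub * uc ^ 2 + ((-2:ℝ)/3) * ub * uc * t + ((-1:ℝ)/3) * uc * X + ((-2:ℝ)/3) * t * X) * β ^ 0 * (1 - β) ^ 3 * γ ^ 1 * (1 - γ) ^ 2) + ((3:ℝ) * (((2:ℝ)/3) * q * ua * t + ((2:ℝ)/3) * q * uc * t + ((1:ℝ)/3) * q * t ^ 2 + ((-1:ℝ)/3) * q * X + ((-2:ℝ)/3) * ua ^ 2 * ub + ((-2:ℝ)/3) * ua ^ 2 * uc + (-1:ℝ) * ua * ub * uc + ((-1:ℝ)/3) * ua * ub * t + ((-2:ℝ)/3) * ua * uc ^ 2 + ((-1:ℝ)/3) * ua * uc * t + ((-2:ℝ)/3) * ua * X + ((-2:ℝ)/3) * ub * uc ^ 2 + ((-1:ℝ)/3) * ub * uc * t + ((-2:ℝ)/3) * uc * X + ((-1:ℝ)/3) * t * X) * β ^ 0 * (1 - β) ^ 3 *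 γ ^ 2 * (1 - γ) ^ 1) + ((1:ℝ) * ((1:ℝ) * q * ua * t + (1:ℝ) * q * uc * t + (-1:ℝ) * q * X + (-1:ℝ) * ua ^ 2 * ub + (-1:ℝ) * ua ^ 2 * uc + (-1:ℝ) * ua * ub * uc + (-1:ℝ) * ua * uc ^ 2 + (-1:ℝ) * ua * X + (-1:ℝ) * ub * uc ^ 2 + (-1:ℝ) * uc * X) * β ^ 0 * (1 - β) ^ 3 * γ ^ 3 * (1 - γ) ^ 0) + ((3:ℝ) * (((1:ℝ)/3) * q * ua * t + ((1:ℝ)/3) * q * ub * t + ((2:ℝ)/3) * q * t ^ 2 + ((1:ℝ)/3) * q * X + ((-1:ℝ)/3) * ua ^ 2 * ub + ((-1:ℝ)/3) * ua ^ 2 * uc + ((-1:ℝ)/3) * ua * ub ^ 2 + (-1:ℝ) * ua * ub * uc + ((-2:ℝ)/3) * ua * ub * t + ((-2:ℝ)/3) * ua * uc * t + ((-1:ℝ)/3) * ua * X + ((-1:ℝ)/3) * ub ^ 2 * uc + ((-2:ℝ)/3) * ub * uc * t + ((-1:ℝ)/3) * ub * X + ((-2:ℝ)/3) * t * X) * β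 ^ 1 * (1 - β) ^ 2 * γ ^ 0 * (1 - γ) ^ 3) + ((9:ℝ) * (((1:ℝ)/9) * q ^ 2 * ua + ((2:ℝ)/9) * q ^ 2 * t + ((5:ℝ)/9) * q * ua * t + ((-1:ℝ)/9) * q * ub * uc + ((4:ℝ)/9) * q * ub * t + ((4:ℝ)/9) * q * uc * t + ((4:ℝ)/9) * q * t ^ 2 + ((-2:ℝ)/9) * q * X + ((-5:ℝ)/9) * ua ^ 2 * ub + ((-5:ℝ)/9) * ua ^ 2 * uc + ((-1:ℝ)/3) * ua * ub ^ 2 + (-1:ℝ) * ua * ub * uc + ((-4:ℝ)/9) * ua * ub * t + ((-1:ℝ)/3) * ua * uc ^ 2 + ((-4:ℝ)/9) * ua * uc * t + ((-5:ℝ)/9) * ua * X + ((-1:ℝ)/3) * ub ^ 2 * uc + ((-1:ℝ)/3) * ub * uc ^ 2 + ((-1:ℝ)/3) * ub * uc * t + ((-1:ℝ)/3) * ub * X + ((-1:ℝ)/3) * uc * X + ((-4:ℝ)/9) * t * X) * β ^ 1 * (1 - β) ^ 2 * γ ^ 1 * (1 - γ) ^ 2) + ((9:ℝ) * (((1:ℝ)/9)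 * q ^ 2 * ua + ((2:ℝ)/9) * q ^ 2 * t + ((5:ℝ)/9) * q * ua * t + ((-1:ℝ)/9) * q * ub * uc + ((1:ℝ)/3) * q * ub * t + ((4:ℝ)/9) * q * uc * t + ((2:ℝ)/9) * q * t ^ 2 + ((-4:ℝ)/9) * q * X + ((-5:ℝ)/9) * ua ^ 2 * ub + ((-5:ℝ)/9) * ua ^ 2 * uc + ((-2:ℝ)/9) * ua * ub ^ 2 + ((-2:ℝ)/3) * ua * ub * uc + ((-2:ℝ)/9) * ua * ub * t + ((-1:ℝ)/3) * ua * uc ^ 2 + ((-2:ℝ)/9) * ua * uc * t + ((-5:ℝ)/9) * ua * X + ((-2:ℝ)/9) * ub ^ 2 * uc + ((-1:ℝ)/3) * ub * uc ^ 2 + ((-1:ℝ)/9) * ub * uc * t + ((-2:ℝ)/9) * ub * X + ((-1:ℝ)/3) * uc * X + ((-2:ℝ)/9) * t * X) * β ^ 1 * (1 - β) ^ 2 * γ ^ 2 * (1 - γ) ^ 1) + ((3:ℝ) * (((1:ℝ)/3) * q * ua * t + ((-1:ℝ)/3) * q * X + ((-1:ℝ)/3) * ua ^ 2 * ub + ((-1:ℝ)/3)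 * ua ^ 2 * uc + ((-1:ℝ)/3) * ua * X) * β ^ 1 * (1 - β) ^ 2 * γ ^ 3 * (1 - γ) ^ 0) + ((3:ℝ) * (((2:ℝ)/3) * q * ua * t + ((2:ℝ)/3) * q * ub * t + ((1:ℝ)/3) * q * t ^ 2 + ((-1:ℝ)/3) * q * X + ((-2:ℝ)/3) * ua ^ 2 * ub + ((-2:ℝ)/3) * ua ^ 2 * uc + ((-2:ℝ)/3) * ua * ub ^ 2 + (-1:ℝ) * ua * ub * uc + ((-1:ℝ)/3) * ua * ub * t + ((-1:ℝ)/3) * ua * uc * t + ((-2:ℝ)/3) * ua * X + ((-2:ℝ)/3) * ub ^ 2 * uc + ((-1:ℝ)/3) * ub * uc * t + ((-2:ℝ)/3) * ub * X + ((-1:ℝ)/3) * t * X) * β ^ 2 * (1 - β) ^ 1 * γ ^ 0 * (1 - γ) ^ 3) + ((9:ℝ) * (((1:ℝ)/9) * q ^ 2 * ua + ((2:ℝ)/9) * q ^ 2 * t + ((5:ℝ)/9) * q * ua * t + ((-1:ℝ)/9) * q * ub * uc + ((4:ℝ)/9) * q * ub * t + ((1:ℝ)/3) * q * uc * t + ((2:ℝ)/9)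 * q * t ^ 2 + ((-4:ℝ)/9) * q * X + ((-5:ℝ)/9) * ua ^ 2 * ub + ((-5:ℝ)/9) * ua ^ 2 * uc + ((-1:ℝ)/3) * ua * ub ^ 2 + ((-2:ℝ)/3) * ua * ub * uc + ((-2:ℝ)/9) * ua * ub * t + ((-2:ℝ)/9) * ua * uc ^ 2 + ((-2:ℝ)/9) * ua * uc * t + ((-5:ℝ)/9) * ua * X + ((-1:ℝ)/3) * ub ^ 2 * uc + ((-2:ℝ)/9) * ub * uc ^ 2 + ((-1:ℝ)/9) * ub * uc * t + ((-1:ℝ)/3) * ub * X + ((-2:ℝ)/9) * uc * X + ((-2:ℝ)/9) * t * X) * β ^ 2 * (1 - β) ^ 1 * γ ^ 1 * (1 - γ) ^ 2) + ((9:ℝ) * (((1:ℝ)/9) * q ^ 2 * ub + ((1:ℝ)/9) * q ^ 2 * uc + ((1:ℝ)/9) * q ^ 2 * t + ((2:ℝ)/9) * q * ua * t + ((1:ℝ)/9) * q * ub ^ 2 + ((2:ℝ)/9) * q * ub * uc + ((2:ℝ)/9) * q * ub * t + ((1:ℝ)/9) * q * uc ^ 2 + ((2:ℝ)/9) * q *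 uc * t + ((1:ℝ)/9) * q * t ^ 2 + ((-2:ℝ)/9) * q * X + ((-2:ℝ)/9) * ua ^ 2 * ub + ((-2:ℝ)/9) * ua ^ 2 * uc + ((-1:ℝ)/9) * ua * ub ^ 2 + ((-2:ℝ)/9) * ua * ub * uc + ((-1:ℝ)/9) * ua * ub * t + ((-1:ℝ)/9) * ua * uc ^ 2 + ((-1:ℝ)/9) * ua * uc * t + ((-2:ℝ)/9) * ua * X + ((-1:ℝ)/9) * ub * X + ((-1:ℝ)/9) * uc * X + ((-1:ℝ)/9) * t * X) * β ^ 2 * (1 - β) ^ 1 * γ ^ 2 * (1 - γ) ^ 1) + ((1:ℝ) * ((1:ℝ) * q * ua * t + (1:ℝ) * q * ub * t + (-1:ℝ) * q * X + (-1:ℝ) * ua ^ 2 * ub + (-1:ℝ) * ua ^ 2 * uc + (-1:ℝ) * ua * ub ^ 2 + (-1:ℝ) * ua * ub * uc + (-1:ℝ) * ua * X + (-1:ℝ) * ub ^ 2 * uc + (-1:ℝ) * ub * X) * β ^ 3 * (1 - β) ^ 0 * γ ^ 0 * (1 - γ) ^ 3) + ((3:ℝ) * (((1:ℝ)/3) *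 q * ua * t + ((-1:ℝ)/3) * q * X + ((-1:ℝ)/3) * ua ^ 2 * ub + ((-1:ℝ)/3) * ua ^ 2 * uc + ((-1:ℝ)/3) * ua * X) * β ^ 3 * (1 - β) ^ 0 * γ ^ 1 * (1 - γ) ^ 2) := by
    simp only [hubPsi0]
    ring
  rw [e]
  exact (add_nonneg (add_nonneg (add_nonneg (add_nonneg (add_nonneg (add_nonneg (add_nonneg (add_nonneg (add_nonneg (add_nonneg (add_nonneg (add_nonneg (mul_nonneg (mul_nonneg (mul_nonneg (mul_nonneg (mul_nonneg (by norm_num : (0:ℝ) ≤ (1:ℝ)) (hubB0_00_nonneg q ua ub uc t X hq hua hub huc ht hW hσ)) (pow_nonneg hβ0 0)) (pow_nonneg hβ1 3)) (pow_nonneg hγ0 0)) (pow_nonneg hγ1 3)) (mul_nonneg (mul_nonneg (mul_nonneg (mul_nonneg (mul_nonneg (by norm_num : (0:ℝ) ≤ (3:ℝ)) (hubB0_01_nonneg q ua ub uc t X hq hua hub huc ht hX hAG hAX hW hCS hσ)) (pow_nonneg hβ0 0)) (pow_nonneg hβ1 3)) (pow_nonneg hγ0 1)) (pow_nonneg hγ1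 2))) (mul_nonneg (mul_nonneg (mul_nonneg (mul_nonneg (mul_nonneg (by norm_num : (0:ℝ) ≤ (3:ℝ)) (hubB0_02_nonneg q ua ub uc t X hua huc ht hAX hCS)) (pow_nonneg hβ0 0)) (pow_nonneg hβ1 3)) (pow_nonneg hγ0 2)) (pow_nonneg hγ1 1))) (mul_nonneg (mul_nonneg (mul_nonneg (mul_nonneg (mul_nonneg (by norm_num : (0:ℝ) ≤ (1:ℝ)) (hubB0_03_nonneg q ua ub uc t X huc hAX hCS)) (pow_nonneg hβ0 0)) (pow_nonneg hβ1 3)) (pow_nonneg hγ0 3)) (pow_nonneg hγ1 0))) (mul_nonneg (mul_nonneg (mul_nonneg (mul_nonneg (mul_nonneg (by norm_num : (0:ℝ) ≤ (3:ℝ)) (hubB0_10_nonneg q ua ub uc t X hq hua hub huc ht hAX hW hσ)) (pow_nonneg hβ0 1)) (pow_nonneg hβ1 2)) (pow_nonneg hγ0 0)) (pow_nonneg hγ1 3))) (mul_nonneg (mul_nonneg (mul_nonneg (mul_nonneg (mul_nonneg (by norm_num : (0:ℝ) ≤ (9:ℝ)) (hubB0_11_nonneg q ua ub uc t X hq hua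 hub huc ht hAG hAX hσ)) (pow_nonneg hβ0 1)) (pow_nonneg hβ1 2)) (pow_nonneg hγ0 1)) (pow_nonneg hγ1 2))) (mul_nonneg (mul_nonneg (mul_nonneg (mul_nonneg (mul_nonneg (by norm_num : (0:ℝ) ≤ (9:ℝ)) (hubB0_12_nonneg q ua ub uc t X hq hua hub huc ht hAX hCS hσ)) (pow_nonneg hβ0 1)) (pow_nonneg hβ1 2)) (pow_nonneg hγ0 2)) (pow_nonneg hγ1 1))) (mul_nonneg (mul_nonneg (mul_nonneg (mul_nonneg (mul_nonneg (by norm_num : (0:ℝ) ≤ (3:ℝ)) (hubB0_13_nonneg q ua ub uc t X hq hua hub huc ht hCS hσ)) (pow_nonneg hβ0 1)) (pow_nonneg hβ1 2)) (pow_nonneg hγ0 3)) (pow_nonneg hγ1 0))) (mul_nonneg (mul_nonneg (mul_nonneg (mul_nonneg (mul_nonneg (by norm_num : (0:ℝ) ≤ (3:ℝ)) (hubB0_20_nonneg q ua ub uc t X hua hub ht hAX hCS)) (pow_nonneg hβ0 2)) (pow_nonneg hβ1 1)) (pow_nonneg hγ0 0)) (pow_nonneg hγ1 3))) (mul_nonneg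 (mul_nonneg (mul_nonneg (mul_nonneg (mul_nonneg (by norm_num : (0:ℝ) ≤ (9:ℝ)) (hubB0_21_nonneg q ua ub uc t X hq hua hub huc ht hX hAX hCS hσ)) (pow_nonneg hβ0 2)) (pow_nonneg hβ1 1)) (pow_nonneg hγ0 1)) (pow_nonneg hγ1 2))) (mul_nonneg (mul_nonneg (mul_nonneg (mul_nonneg (mul_nonneg (by norm_num : (0:ℝ) ≤ (9:ℝ)) (hubB0_22_nonneg q ua ub uc t X hq hub huc ht hAG hAX hCS hσ)) (pow_nonneg hβ0 2)) (pow_nonneg hβ1 1)) (pow_nonneg hγ0 2)) (pow_nonneg hγ1 1))) (mul_nonneg (mul_nonneg (mul_nonneg (mul_nonneg (mul_nonneg (by norm_num : (0:ℝ) ≤ (1:ℝ)) (hubB0_30_nonneg q ua ub uc t X hub hAX hCS)) (pow_nonneg hβ0 3)) (pow_nonneg hβ1 0)) (pow_nonneg hγ0 0)) (pow_nonneg hγ1 3))) (mul_nonneg (mul_nonneg (mul_nonneg (mul_nonneg (mul_nonneg (by norm_num : (0:ℝ) ≤ (3:ℝ)) (hubB0_31_nonneg q ua ub uc t X hq hua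 hub huc ht hCS hσ)) (pow_nonneg hβ0 3)) (pow_nonneg hβ1 0)) (pow_nonneg hγ0 1)) (pow_nonneg hγ1 2)))

set_option maxHeartbeats 4000000 in
/-- `Ψ1 ≥ 0` on the hypothesis set, for all arm weights `β, γ ∈ [0,1]` (Bernstein expansion in `(β,γ)` + the coefficient certificates).
[conjecture-support: hub-gluing step of W_a] -/
theorem hubPsi1_nonneg (q ua ub uc t X : ℝ) (hq : 0 ≤ q) (hua : 0 ≤ ua) (hub : 0 ≤ ub) (huc : 0 ≤ uc) (ht : 0 ≤ t) (hX : 0 ≤ X)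
    (hσ : q + ua + ub + uc + t = 1) (hAG : 0 ≤ AG q ua ub uc t) (hAX : 0 ≤ AG q ua ub uc t - X)
    (hW : 0 ≤ Ha q ua ub uc t - (t - q) * X) (hCS : 0 ≤ ua * (AG q ua ub uc t + ub * uc) - (q + ua) * X)
    (β γ : ℝ) (hβ0 : 0 ≤ β) (hβ1 : 0 ≤ 1 - β) (hγ0 : 0 ≤ γ) (hγ1 : 0 ≤ 1 - γ) :
    0 ≤ hubPsi1 q ua ub uc t X β γ := by
  have e : hubPsi1 q ua ub uc t X β γ = ((1:ℝ) * ((1:ℝ) * q * t ^ 2 + (1:ℝ) * q * X + (-1:ℝ) * ua * ub * uc + (-1:ℝ) * ua * ub * t + (-1:ℝ) * ua * uc * t + (-1:ℝ) * ub * uc * t + (-1:ℝ) * t * X) * β ^ 0 * (1 - β) ^ 3 * γ ^ 0 * (1 - γ) ^ 3) + ((3:ℝ) * (((1:ℝ)/3) * q * ua * t + ((1:ℝ)/3) * q * uc * t + ((2:ℝ)/3) * q * t ^ 2 + ((1:ℝ)/3) * q * X + ((-1:ℝ)/3) * ua ^ 2 * ub + ((-1:ℝ)/3) * ua ^ 2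 * uc + (-1:ℝ) * ua * ub * uc + ((-2:ℝ)/3) * ua * ub * t + ((-1:ℝ)/3) * ua * uc ^ 2 + ((-2:ℝ)/3) * ua * uc * t + ((-1:ℝ)/3) * ua * X + ((-1:ℝ)/3) * ub * uc ^ 2 + ((-2:ℝ)/3) * ub * uc * t + ((-1:ℝ)/3) * uc * X + ((-2:ℝ)/3) * t * X) * β ^ 0 * (1 - β) ^ 3 * γ ^ 1 * (1 - γ) ^ 2) + ((3:ℝ) * (((2:ℝ)/3) * q * ua * t + ((2:ℝ)/3) * q * uc * t + ((1:ℝ)/3) * q * t ^ 2 + ((-1:ℝ)/3) * q * X + ((-2:ℝ)/3) * ua ^ 2 * ub + ((-2:ℝ)/3) * ua ^ 2 * uc + (-1:ℝ) * ua * ub * uc + ((-1:ℝ)/3) * ua * ub * t + ((-2:ℝ)/3) * ua * uc ^ 2 + ((-1:ℝ)/3) * ua * uc * t + ((-2:ℝ)/3) * ua * X + ((-2:ℝ)/3) * ub * uc ^ 2 + ((-1:ℝ)/3) * ub * uc * t + ((-2:ℝ)/3) * uc * X + ((-1:ℝ)/3) * t * X) * β ^ 0 * (1 - β) ^ 3 *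 γ ^ 2 * (1 - γ) ^ 1) + ((1:ℝ) * ((1:ℝ) * q * ua * t + (1:ℝ) * q * uc * t + (-1:ℝ) * q * X + (-1:ℝ) * ua ^ 2 * ub + (-1:ℝ) * ua ^ 2 * uc + (-1:ℝ) * ua * ub * uc + (-1:ℝ) * ua * uc ^ 2 + (-1:ℝ) * ua * X + (-1:ℝ) * ub * uc ^ 2 + (-1:ℝ) * uc * X) * β ^ 0 * (1 - β) ^ 3 * γ ^ 3 * (1 - γ) ^ 0) + ((3:ℝ) * (((1:ℝ)/3) * q * ua * t + ((1:ℝ)/3) * q * ub * t + ((2:ℝ)/3) * q * t ^ 2 + ((1:ℝ)/3) * q * X + ((-1:ℝ)/3) * ua ^ 2 * ub + ((-1:ℝ)/3) * ua ^ 2 * uc + ((-1:ℝ)/3) * ua * ub ^ 2 + (-1:ℝ) * ua * ub * uc + ((-2:ℝ)/3) * ua * ub * t + ((-2:ℝ)/3) * ua * uc * t + ((-1:ℝ)/3) * ua * X + ((-1:ℝ)/3) * ub ^ 2 * uc + ((-2:ℝ)/3) * ub * uc * t + ((-1:ℝ)/3) * ub * X + ((-2:ℝ)/3) * t * X) * β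 ^ 1 * (1 - β) ^ 2 * γ ^ 0 * (1 - γ) ^ 3) + ((9:ℝ) * (((1:ℝ)/9) * q ^ 2 * ua + ((2:ℝ)/9) * q ^ 2 * t + ((5:ℝ)/9) * q * ua * t + ((-1:ℝ)/9) * q * ub * uc + ((4:ℝ)/9) * q * ub * t + ((4:ℝ)/9) * q * uc * t + ((4:ℝ)/9) * q * t ^ 2 + ((-2:ℝ)/9) * q * X + ((-5:ℝ)/9) * ua ^ 2 * ub + ((-5:ℝ)/9) * ua ^ 2 * uc + ((-1:ℝ)/3) * ua * ub ^ 2 + (-1:ℝ) * ua * ub * uc + ((-4:ℝ)/9) * ua * ub * t + ((-1:ℝ)/3) * ua * uc ^ 2 + ((-4:ℝ)/9) * ua * uc * t + ((-5:ℝ)/9) * ua * X + ((-1:ℝ)/3) * ub ^ 2 * uc + ((-1:ℝ)/3) * ub * uc ^ 2 + ((-1:ℝ)/3) * ub * uc * t + ((-1:ℝ)/3) * ub * X + ((-1:ℝ)/3) * uc * X + ((-4:ℝ)/9) * t * X) * β ^ 1 * (1 - β) ^ 2 * γ ^ 1 * (1 - γ) ^ 2) + ((9:ℝ) * (((1:ℝ)/9)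 * q ^ 2 * ua + ((1:ℝ)/9) * q ^ 2 * uc + ((2:ℝ)/9) * q ^ 2 * t + ((5:ℝ)/9) * q * ua * t + ((1:ℝ)/3) * q * ub * t + ((1:ℝ)/9) * q * uc ^ 2 + ((4:ℝ)/9) * q * uc * t + ((2:ℝ)/9) * q * t ^ 2 + ((-4:ℝ)/9) * q * X + ((-5:ℝ)/9) * ua ^ 2 * ub + ((-5:ℝ)/9) * ua ^ 2 * uc + ((-2:ℝ)/9) * ua * ub ^ 2 + ((-2:ℝ)/3) * ua * ub * uc + ((-2:ℝ)/9) * ua * ub * t + ((-1:ℝ)/3) * ua * uc ^ 2 + ((-2:ℝ)/9) * ua * uc * t + ((-5:ℝ)/9) * ua * X + ((-2:ℝ)/9) * ub ^ 2 * uc + ((-2:ℝ)/9) * ub * uc ^ 2 + ((-1:ℝ)/9) * ub * uc * t + ((-2:ℝ)/9) * ub * X + ((-1:ℝ)/3) * uc * X + ((-2:ℝ)/9) * t * X) * β ^ 1 * (1 - β) ^ 2 * γ ^ 2 * (1 - γ) ^ 1) + ((3:ℝ) * (((1:ℝ)/3) * q * ua * t + ((-1:ℝ)/3) * q * X + ((-1:ℝ)/3)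 * ua ^ 2 * ub + ((-1:ℝ)/3) * ua ^ 2 * uc + ((-1:ℝ)/3) * ua * X) * β ^ 1 * (1 - β) ^ 2 * γ ^ 3 * (1 - γ) ^ 0) + ((3:ℝ) * (((2:ℝ)/3) * q * ua * t + ((2:ℝ)/3) * q * ub * t + ((1:ℝ)/3) * q * t ^ 2 + ((-1:ℝ)/3) * q * X + ((-2:ℝ)/3) * ua ^ 2 * ub + ((-2:ℝ)/3) * ua ^ 2 * uc + ((-2:ℝ)/3) * ua * ub ^ 2 + (-1:ℝ) * ua * ub * uc + ((-1:ℝ)/3) * ua * ub * t + ((-1:ℝ)/3) * ua * uc * t + ((-2:ℝ)/3) * ua * X + ((-2:ℝ)/3) * ub ^ 2 * uc + ((-1:ℝ)/3) * ub * uc * t + ((-2:ℝ)/3) * ub * X + ((-1:ℝ)/3) * t * X) * β ^ 2 * (1 - β) ^ 1 * γ ^ 0 * (1 - γ) ^ 3) + ((9:ℝ) * (((1:ℝ)/9) * q ^ 2 * ua + ((1:ℝ)/9) * q ^ 2 * ub + ((2:ℝ)/9) * q ^ 2 * t + ((5:ℝ)/9) * q * ua * t + ((1:ℝ)/9) * q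 * ub ^ 2 + ((4:ℝ)/9) * q * ub * t + ((1:ℝ)/3) * q * uc * t + ((2:ℝ)/9) * q * t ^ 2 + ((-4:ℝ)/9) * q * X + ((-5:ℝ)/9) * ua ^ 2 * ub + ((-5:ℝ)/9) * ua ^ 2 * uc + ((-1:ℝ)/3) * ua * ub ^ 2 + ((-2:ℝ)/3) * ua * ub * uc + ((-2:ℝ)/9) * ua * ub * t + ((-2:ℝ)/9) * ua * uc ^ 2 + ((-2:ℝ)/9) * ua * uc * t + ((-5:ℝ)/9) * ua * X + ((-2:ℝ)/9) * ub ^ 2 * uc + ((-2:ℝ)/9) * ub * uc ^ 2 + ((-1:ℝ)/9) * ub * uc * t + ((-1:ℝ)/3) * ub * X + ((-2:ℝ)/9) * uc * X + ((-2:ℝ)/9) * t * X) * β ^ 2 * (1 - β) ^ 1 * γ ^ 1 * (1 - γ) ^ 2) + ((9:ℝ) * (((1:ℝ)/9) * q ^ 2 * ub + ((1:ℝ)/9) * q ^ 2 * uc + ((1:ℝ)/9) * q ^ 2 * t + ((2:ℝ)/9) * q * ua * t + ((1:ℝ)/9) * q * ub ^ 2 + ((2:ℝ)/9) * q * ub *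 uc + ((2:ℝ)/9) * q * ub * t + ((1:ℝ)/9) * q * uc ^ 2 + ((2:ℝ)/9) * q * uc * t + ((1:ℝ)/9) * q * t ^ 2 + ((-2:ℝ)/9) * q * X + ((-2:ℝ)/9) * ua ^ 2 * ub + ((-2:ℝ)/9) * ua ^ 2 * uc + ((-1:ℝ)/9) * ua * ub ^ 2 + ((-2:ℝ)/9) * ua * ub * uc + ((-1:ℝ)/9) * ua * ub * t + ((-1:ℝ)/9) * ua * uc ^ 2 + ((-1:ℝ)/9) * ua * uc * t + ((-2:ℝ)/9) * ua * X + ((-1:ℝ)/9) * ub * X + ((-1:ℝ)/9) * uc * X + ((-1:ℝ)/9) * t * X) * β ^ 2 * (1 - β) ^ 1 * γ ^ 2 * (1 - γ) ^ 1) + ((1:ℝ) * ((1:ℝ) * q * ua * t + (1:ℝ) * q * ub * t + (-1:ℝ) * q * X + (-1:ℝ) * ua ^ 2 * ub + (-1:ℝ) * ua ^ 2 * uc + (-1:ℝ) * ua * ub ^ 2 + (-1:ℝ) * ua * ub * uc + (-1:ℝ) * ua * X + (-1:ℝ) * ub ^ 2 * uc + (-1:ℝ) * ub * X) * β ^ 3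 * (1 - β) ^ 0 * γ ^ 0 * (1 - γ) ^ 3) + ((3:ℝ) * (((1:ℝ)/3) * q * ua * t + ((-1:ℝ)/3) * q * X + ((-1:ℝ)/3) * ua ^ 2 * ub + ((-1:ℝ)/3) * ua ^ 2 * uc + ((-1:ℝ)/3) * ua * X) * β ^ 3 * (1 - β) ^ 0 * γ ^ 1 * (1 - γ) ^ 2) := by
    simp only [hubPsi1]
    ring
  rw [e]
  exact (add_nonneg (add_nonneg (add_nonneg (add_nonneg (add_nonneg (add_nonneg (add_nonneg (add_nonneg (add_nonneg (add_nonneg (add_nonneg (add_nonneg (mul_nonneg (mul_nonneg (mul_nonneg (mul_nonneg (mul_nonneg (by norm_num : (0:ℝ) ≤ (1:ℝ)) (hubB0_00_nonneg q ua ub uc t X hq hua hub huc ht hW hσ)) (pow_nonneg hβ0 0)) (pow_nonneg hβ1 3)) (pow_nonneg hγ0 0)) (pow_nonneg hγ1 3)) (mul_nonneg (mul_nonneg (mul_nonneg (mul_nonneg (mul_nonneg (by norm_num : (0:ℝ) ≤ (3:ℝ)) (hubB0_01_nonneg q ua ub uc t X hq hua hub huc ht hX hAG hAX hW hCS hσ))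 (pow_nonneg hβ0 0)) (pow_nonneg hβ1 3)) (pow_nonneg hγ0 1)) (pow_nonneg hγ1 2))) (mul_nonneg (mul_nonneg (mul_nonneg (mul_nonneg (mul_nonneg (by norm_num : (0:ℝ) ≤ (3:ℝ)) (hubB0_02_nonneg q ua ub uc t X hua huc ht hAX hCS)) (pow_nonneg hβ0 0)) (pow_nonneg hβ1 3)) (pow_nonneg hγ0 2)) (pow_nonneg hγ1 1))) (mul_nonneg (mul_nonneg (mul_nonneg (mul_nonneg (mul_nonneg (by norm_num : (0:ℝ) ≤ (1:ℝ)) (hubB0_03_nonneg q ua ub uc t X huc hAX hCS)) (pow_nonneg hβ0 0)) (pow_nonneg hβ1 3)) (pow_nonneg hγ0 3)) (pow_nonneg hγ1 0))) (mul_nonneg (mul_nonneg (mul_nonneg (mul_nonneg (mul_nonneg (by norm_num : (0:ℝ) ≤ (3:ℝ)) (hubB0_10_nonneg q ua ub uc t X hq hua hub huc ht hAX hW hσ)) (pow_nonneg hβ0 1)) (pow_nonneg hβ1 2)) (pow_nonneg hγ0 0)) (pow_nonneg hγ1 3))) (mul_nonneg (mul_nonneg (mul_nonneg (mul_nonneg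 (mul_nonneg (by norm_num : (0:ℝ) ≤ (9:ℝ)) (hubB0_11_nonneg q ua ub uc t X hq hua hub huc ht hAG hAX hσ)) (pow_nonneg hβ0 1)) (pow_nonneg hβ1 2)) (pow_nonneg hγ0 1)) (pow_nonneg hγ1 2))) (mul_nonneg (mul_nonneg (mul_nonneg (mul_nonneg (mul_nonneg (by norm_num : (0:ℝ) ≤ (9:ℝ)) (hubB1_12_nonneg q ua ub uc t X hq hua hub huc ht hAX hCS hσ)) (pow_nonneg hβ0 1)) (pow_nonneg hβ1 2)) (pow_nonneg hγ0 2)) (pow_nonneg hγ1 1))) (mul_nonneg (mul_nonneg (mul_nonneg (mul_nonneg (mul_nonneg (by norm_num : (0:ℝ) ≤ (3:ℝ)) (hubB0_13_nonneg q ua ub uc t X hq hua hub huc ht hCS hσ)) (pow_nonneg hβ0 1)) (pow_nonneg hβ1 2)) (pow_nonneg hγ0 3)) (pow_nonneg hγ1 0))) (mul_nonneg (mul_nonneg (mul_nonneg (mul_nonneg (mul_nonneg (by norm_num : (0:ℝ) ≤ (3:ℝ)) (hubB0_20_nonneg q ua ub uc t X hua hub ht hAX hCS)) (pow_nonneg hβ0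 2)) (pow_nonneg hβ1 1)) (pow_nonneg hγ0 0)) (pow_nonneg hγ1 3))) (mul_nonneg (mul_nonneg (mul_nonneg (mul_nonneg (mul_nonneg (by norm_num : (0:ℝ) ≤ (9:ℝ)) (hubB1_21_nonneg q ua ub uc t X hq hua hub huc ht hX hAG hAX hW hCS hσ)) (pow_nonneg hβ0 2)) (pow_nonneg hβ1 1)) (pow_nonneg hγ0 1)) (pow_nonneg hγ1 2))) (mul_nonneg (mul_nonneg (mul_nonneg (mul_nonneg (mul_nonneg (by norm_num : (0:ℝ) ≤ (9:ℝ)) (hubB0_22_nonneg q ua ub uc t X hq hub huc ht hAG hAX hCS hσ)) (pow_nonneg hβ0 2)) (pow_nonneg hβ1 1)) (pow_nonneg hγ0 2)) (pow_nonneg hγ1 1))) (mul_nonneg (mul_nonneg (mul_nonneg (mul_nonneg (mul_nonneg (by norm_num : (0:ℝ) ≤ (1:ℝ)) (hubB0_30_nonneg q ua ub uc t X hub hAX hCS)) (pow_nonneg hβ0 3)) (pow_nonneg hβ1 0)) (pow_nonneg hγ0 0)) (pow_nonneg hγ1 3))) (mul_nonneg (mul_nonneg (mul_nonneg (mul_nonneg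 (mul_nonneg (by norm_num : (0:ℝ) ≤ (3:ℝ)) (hubB0_31_nonneg q ua ub uc t X hq hua hub huc ht hCS hσ)) (pow_nonneg hβ0 3)) (pow_nonneg hβ1 0)) (pow_nonneg hγ0 1)) (pow_nonneg hγ1 2)))

/-! ### The glued shadow slack -/

/-- The shadow slack of the glued graph `G₋ ⊕ hub(s; p, β, γ)` as delivered by the exact one-edge formulas (W-SHADOW.md Theorems 3, 4, 6b):
`(1−p)·S(G₋+bc(βγ)) + p²·S(G₋+ab(β)+ac(γ)) + p(1−p)[(1−p)Ψ₀ + pΨ₁]` with `S(G₋+bc(ρ)) = (1−ρ)²[S + ρ(1−a_a)Y]`,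
`S(G₋+ab(β)+ac(γ)) = (1−β)(1−γ)[(1−β)(1−γ)S + (β(1−γ)(1−d_c) + γ(1−(1−β)d_b))Y]`, `S = Ha − (t−q)X`, `Y = AG − X`, `a_a = t+ua`, `d_b = q+ub`,
`d_c = q+uc`. [conjecture-support: algebraic definition] -/
noncomputable def hubGlued (q ua ub uc t X β γ p : ℝ) : ℝ :=
  let S := Ha q ua ub uc t - (t - q) * X
  let Y := AG q ua ub uc t - X
  let ρ := β * γ
  (1 - p) * ((1 - ρ) ^ 2 * (S + ρ * (1 - (t + ua)) * Y))
    + p ^ 2 * ((1 - β) * (1 - γ) * ((1 - β) * (1 - γ) * S + (β * (1 - γ) * (1 - (q + uc)) + γ * (1 - (1 - β) * (q + ub))) * Y))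
    + p * (1 - p) * ((1 - p) * hubPsi0 q ua ub uc t X β γ + p * hubPsi1 q ua ub uc t X β γ)

/-- HUB GLUING (algebraic form): under W_a and V_a for `G₋` the glued shadow slack is nonnegative for all arm weights — i.e. Conjecture W_a is closed
under gluing a hub, modulo the (paper-proved, not formalised) identification of `hubGlued` with `S_a` of the glued graph. [conjecture-support: hub-gluing step of W_a] -/
theorem hubGlued_nonneg (q ua ub uc t X : ℝ) (hq : 0 ≤ q) (hua : 0 ≤ ua) (hub : 0 ≤ ub) (huc : 0 ≤ uc) (ht : 0 ≤ t) (hX : 0 ≤ X)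
    (hσ : q + ua + ub + uc + t = 1) (hAG : 0 ≤ AG q ua ub uc t) (hAX : 0 ≤ AG q ua ub uc t - X)
    (hW : 0 ≤ Ha q ua ub uc t - (t - q) * X) (hCS : 0 ≤ ua * (AG q ua ub uc t + ub * uc) - (q + ua) * X)
    (β γ p : ℝ) (hβ0 : 0 ≤ β) (hβ1 : 0 ≤ 1 - β) (hγ0 : 0 ≤ γ) (hγ1 : 0 ≤ 1 - γ) (hp0 : 0 ≤ p) (hp1 : 0 ≤ 1 - p) :
    0 ≤ hubGlued q ua ub uc t X β γ p := by
  have h0 := hubPsi0_nonneg q ua ub uc t X hq hua hub huc ht hX hσ hAG hAX hW hCS β γ hβ0 hβ1 hγ0 hγ1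
  have h1 := hubPsi1_nonneg q ua ub uc t X hq hua hub huc ht hX hσ hAG hAX hW hCS β γ hβ0 hβ1 hγ0 hγ1
  have hY : 0 ≤ AG q ua ub uc t - X := hAX
  have haa : 0 ≤ 1 - (t + ua) := by linarith
  have hdc : 0 ≤ 1 - (q + uc) := by linarith
  have hdb : 0 ≤ 1 - (1 - β) * (q + ub) := by nlinarith [mul_nonneg hβ0 (add_nonneg hq hub)]
  have hρ : 0 ≤ β * γ := mul_nonneg hβ0 hγ0
  simp only [hubGlued]
  have t1 : 0 ≤ (1 - p) * ((1 - β * γ) ^ 2 * ((Ha q ua ub uc t - (t - q) * X) + β * γ * (1 - (t + ua)) * (AG q ua ub uc t - X))) :=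
    mul_nonneg hp1 (mul_nonneg (sq_nonneg _) (add_nonneg hW (mul_nonneg (mul_nonneg hρ haa) hY)))
  have t2 : 0 ≤ p ^ 2 * ((1 - β) * (1 - γ) * ((1 - β) * (1 - γ) * (Ha q ua ub uc t - (t - q) * X)
      + (β * (1 - γ) * (1 - (q + uc)) + γ * (1 - (1 - β) * (q + ub))) * (AG q ua ub uc t - X))) :=
    mul_nonneg (sq_nonneg _) (mul_nonneg (mul_nonneg hβ1 hγ1) (add_nonneg (mul_nonneg (mul_nonneg hβ1 hγ1) hW)
      (mul_nonneg (add_nonneg (mul_nonneg (mul_nonneg hβ0 hγ1) hdc) (mul_nonneg hγ0 hdb)) hY)))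
  have t3 : 0 ≤ p * (1 - p) * ((1 - p) * hubPsi0 q ua ub uc t X β γ + p * hubPsi1 q ua ub uc t X β γ) :=
    mul_nonneg (mul_nonneg hp0 hp1) (add_nonneg (mul_nonneg hp1 h0) (mul_nonneg hp0 h1))
  linarith

end CubicThreePointShadow

end Summit.CriticalPhenomena.PercolationContinuityZ3.Theorems
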